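import Mathlib.Data.Nat.Log
import Mathlib.Algebra.Polynomial.Eval.Degree
import Mathlib.Algebra.Order.BigOperators.Group.Finset
import Mathlib.Logic.Function.Iterate
import Mathlib.Tactic.Ring
import Mathlib.Tactic.Linarith
import Mathlib.Tactic.NormNum
import Mathlib.Tactic.GCongr
import Mathlib.Tactic.IntervalCases
import HarnessLib

/-!
# Parameters of the `2^{O(n / log n)}`-time algorithm of Hirahara's Thm. 6.3 / Cor. 6.4 (arithmetic)

Topic `Literature/Computability/MetaComplexity`, arithmetic layer of the discharge of
`Hirahara2021_mem_DTIME_of_hasUHS` (`UniversalHeuristicSchemes.lean`; Hirahara, ECCC TR21-058,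
Thm. 6.3 and Cor. 6.4). The printed proof chooses "`I := ε log n` for a small constant `ε > 0`" and
`k := (n + O(1))/I`, and bounds the running time `poly(p_I(n), 2^k)` by `2^{O(n / log n)}` using
`p_i(n) ≤ n^{c^i}`. This file fixes concrete integer parameters and proves those estimates once, with
explicit constants, in the form consumed by the machine (no machine here):

* `UHSParam.I d n = ⌊log₂ n⌋ / (2d) + 1`, `UHSParam.k d a₀ n = (n + a₀) / I`,
  `UHSParam.E d n = (2^d)^I · (⌊log₂ (n+2)⌋ + 1)` (an upper bound on `log₂` of every iterate
  `p_i(n)`, `i ≤ I`, when `p(m) + 2 ≤ (m + 2)^{2^d}`), the pad exponent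
  `UHSParam.m d a₀ n = 2k + 2 + (2E + 2 + I)` (the length of the word `⟨1ᵏ, ⟨1ᴱ, 1ᴵ⟩⟩`), and
  `UHSParam.mtot = m + ⌊log₂ n⌋ + 1` (absorbing polynomial factors in `n`);
* `UHSParam.lt_I_mul_succ_k` — the pigeonhole hypothesis `n + a₀ < I (k + 1)` of
  `exists_checker_accepts_iterate` (`UniversalHeuristicSchemesProofs.lean`);
* `UHSParam.exists_pow_bound` — every `ℕ`-polynomial satisfies `p(m) + 2 ≤ (m + 2)^{2^d}` for some
  `d ≥ 1`; `UHSParam.iterate_add_two_le` — then `p_i(n) + 2 ≤ (n + 2)^{(2^d)^i}`;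
  `UHSParam.iterate_lt_two_pow_E` — so `p_i(n) < 2^E` for `i ≤ I`;
* `UHSParam.mtot_mul_log_le` — **the exponent is `O(n / log n)`**: `mtot · ⌊log₂ n⌋ ≤ c · n` for
  an explicit `c` and all `n` (via `(2^d)^I ≤ 2^d · 2^{⌊log₂ n⌋/2}`, `(2^{L/2})² ≤ n`, and the
  polylog estimate `(L + 3)^2 ≤ 18 · 2^{L/2}`);
* `UHSParam.exists_time_bound` — the final bookkeeping: for all `A, B`,
  `A · 2^{B · mtot(n)} + A ≤ c · 2^{c · n / ⌊log₂ n⌋} + c` for some `c` and all `n` (for `n ≤ 1`,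
  where `⌊log₂ n⌋ = 0`, the right-hand side is the constant `2c`).

## References

* S. Hirahara, *Average-case hardness of NP from exponential worst-case hardness assumptions*,
  STOC 2021; full version ECCC TR21-058: proof of Thm. 6.3 (choice of `I`, `k`; the bounds
  `p_i(n) ≤ n^{c^i}` and `poly(p_I(n), 2^k) ≤ 2^{O(n / log n)}`), Cor. 6.4.
-/

namespace Literature.Computability.MetaComplexity

namespace UHSParam

/-! ### The parameters -/

/-- Number of iterates searched: `I = ⌊log₂ n⌋ / (2d) + 1` (the paper's `I = ε log n` with
`ε = 1/(2d)`, made positive). [Hirahara 2021 (ECCC TR21-058), proof of Thm. 6.3]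
[cite: Hirahara2021, Thm. 6.3 (proof)] -/
def I (d n : ℕ) : ℕ := Nat.log 2 n / (2 * d) + 1

/-- Depth threshold: `k = (n + a₀) / I`. [Hirahara 2021 (ECCC TR21-058), proof of Thm. 6.3
("`k := s(n)/I`" with `s(n) = n + O(1)`)] [cite: Hirahara2021, Thm. 6.3 (proof)] -/
def k (d a₀ n : ℕ) : ℕ := (n + a₀) / I d n

/-- Bit-length bound for the iterates: `E = (2^d)^I · (⌊log₂ (n + 2)⌋ + 1)`, so that
`(n + 2)^{(2^d)^I} ≤ 2^E`. [Hirahara 2021 (ECCC TR21-058), proof of Thm. 6.3 (`p_i(n) ≤ n^{c^i}`)]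
[cite: Hirahara2021, Thm. 6.3 (proof)] -/
def E (d n : ℕ) : ℕ := (2 ^ d) ^ I d n * (Nat.log 2 (n + 2) + 1)

/-- The pad exponent `m = 2k + 2 + (2E + 2 + I)`: the length of the parameter word
`⟨1ᵏ, ⟨1ᴱ, 1ᴵ⟩⟩` (pairing doubles the first component and adds a 2-symbol separator).
[folklore] -/
def m (d a₀ n : ℕ) : ℕ := 2 * k d a₀ n + 2 + (2 * E d n + 2 + I d n)

/-- The total exponent `mtot = m + ⌊log₂ n⌋ + 1`, which also dominates `log₂ (n + 1)` (so that
`poly(2^m, n) ≤ 2^{O(mtot)}`). [folklore] -/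
def mtot (d a₀ n : ℕ) : ℕ := m d a₀ n + Nat.log 2 n + 1

/-- `I ≥ 1`. [folklore] -/
theorem one_le_I (d n : ℕ) : 1 ≤ I d n := Nat.le_add_left 1 _

/-- **The pigeonhole hypothesis**: `n + a₀ < I · (k + 1)`. [Hirahara 2021 (ECCC TR21-058), proof
of Thm. 6.3] [cite: Hirahara2021, Thm. 6.3 (proof)] -/
theorem lt_I_mul_succ_k (d a₀ n : ℕ) : n + a₀ < I d n * (k d a₀ n + 1) := by
  unfold k
  exact Nat.lt_mul_div_succ _ (one_le_I d n)

/-- `k ≤ n + a₀`. [folklore] -/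
theorem k_le (d a₀ n : ℕ) : k d a₀ n ≤ n + a₀ := Nat.div_le_self _ _

/-- `k ≤ m`. [folklore] -/
theorem k_le_m (d a₀ n : ℕ) : k d a₀ n ≤ m d a₀ n := by unfold m; omega

/-- `E ≤ m`. [folklore] -/
theorem E_le_m (d a₀ n : ℕ) : E d n ≤ m d a₀ n := by unfold m; omega

/-- `m ≤ mtot` and `⌊log₂ n⌋ + 1 ≤ mtot`. [folklore] -/
theorem m_le_mtot (d a₀ n : ℕ) : m d a₀ n ≤ mtot d a₀ n := by unfold mtot; omega

/-- `n < 2^{mtot}` (indeed `n < 2^{⌊log₂ n⌋ + 1}`). [folklore] -/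
theorem lt_two_pow_mtot (d a₀ n : ℕ) : n < 2 ^ mtot d a₀ n :=
  (Nat.lt_pow_succ_log_self one_lt_two n).trans_le
    (Nat.pow_le_pow_right two_pos (by unfold mtot; omega))

/-! ### A polynomial is dominated by a power of `m + 2` -/

/-- Every `ℕ`-polynomial satisfies `p(m) + 2 ≤ (m + 2)^{2^d}` for some `d ≥ 1` and all `m`.
(Each monomial `c·mⁱ ≤ c (m+2)^{deg}`, `Σ c = p(1) ≤ (m+2)^{p(1)}`, and two more factors
`m + 2 ≥ 2` absorb the `+ 2`; finally `p(1) + deg + 2 ≤ 2^d`.) [folklore] -/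
theorem exists_pow_bound (p : Polynomial ℕ) :
    ∃ d : ℕ, 1 ≤ d ∧ ∀ m : ℕ, p.eval m + 2 ≤ (m + 2) ^ (2 ^ d) := by
  have h1 : ∀ m : ℕ, p.eval m ≤ p.eval 1 * (m + 2) ^ p.natDegree := by
    intro m
    rw [Polynomial.eval_eq_sum_range, Polynomial.eval_eq_sum_range, Finset.sum_mul]
    refine Finset.sum_le_sum fun i hi => ?_
    have hi' : i ≤ p.natDegree := Nat.lt_succ_iff.mp (Finset.mem_range.mp hi)
    calc p.coeff i * m ^ i ≤ p.coeff i * (m + 2) ^ i :=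
          Nat.mul_le_mul_left _ (Nat.pow_le_pow_left (by omega) i)
      _ ≤ p.coeff i * (m + 2) ^ p.natDegree :=
          Nat.mul_le_mul_left _ (Nat.pow_le_pow_right (by omega) hi')
      _ = p.coeff i * 1 ^ i * (m + 2) ^ p.natDegree := by rw [one_pow, mul_one]
  set a := p.eval 1 + p.natDegree + 2 with ha
  obtain ⟨d, hd1, hda⟩ : ∃ d : ℕ, 1 ≤ d ∧ a ≤ 2 ^ d :=
    ⟨a + 1, by omega, (Nat.lt_two_pow_self).le.trans (Nat.pow_le_pow_right (by norm_num) (by omega))⟩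
  refine ⟨d, hd1, fun m => ?_⟩
  have hm2 : 2 ≤ m + 2 := by omega
  have h2 : p.eval 1 ≤ (m + 2) ^ p.eval 1 :=
    (Nat.lt_two_pow_self).le.trans (Nat.pow_le_pow_left hm2 _)
  have hX : 1 ≤ (m + 2) ^ (p.eval 1 + p.natDegree) := Nat.one_le_pow _ _ (by omega)
  have hsq : 4 ≤ (m + 2) ^ 2 := by nlinarith
  calc p.eval m + 2 ≤ p.eval 1 * (m + 2) ^ p.natDegree + 2 := Nat.add_le_add_right (h1 m) 2
    _ ≤ (m + 2) ^ p.eval 1 * (m + 2) ^ p.natDegree + 2 :=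
        Nat.add_le_add_right (Nat.mul_le_mul_right _ h2) 2
    _ = (m + 2) ^ (p.eval 1 + p.natDegree) + 2 := by rw [pow_add]
    _ ≤ (m + 2) ^ (p.eval 1 + p.natDegree) * (m + 2) ^ 2 := by nlinarith
    _ = (m + 2) ^ a := by rw [ha, ← pow_add]
    _ ≤ (m + 2) ^ (2 ^ d) := Nat.pow_le_pow_right (by omega) hda

/-! ### The iterates stay below `2^E` -/

/-- If `p(m) + 2 ≤ (m + 2)^D` for all `m`, then the iterates satisfy `p_i(n) + 2 ≤ (n + 2)^{D^i}`.
[Hirahara 2021 (ECCC TR21-058), proof of Thm. 6.3 ("by induction, `p_i(n) ≤ n^{c^i}`")]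
[cite: Hirahara2021, Thm. 6.3 (proof)] -/
theorem iterate_add_two_le {p : Polynomial ℕ} {D : ℕ} (hp : ∀ m, p.eval m + 2 ≤ (m + 2) ^ D)
    (n : ℕ) : ∀ i : ℕ, (fun m => p.eval m)^[i] n + 2 ≤ (n + 2) ^ (D ^ i)
  | 0 => by simp
  | i + 1 => by
    rw [Function.iterate_succ_apply', pow_succ, pow_mul]
    exact (hp _).trans (Nat.pow_le_pow_left (iterate_add_two_le hp n i) D)

/-- `n + 2 ≤ 2^{⌊log₂ (n+2)⌋ + 1}`. [folklore] -/
theorem add_two_le_two_pow_log (n : ℕ) : n + 2 ≤ 2 ^ (Nat.log 2 (n + 2) + 1) :=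
  (Nat.lt_pow_succ_log_self one_lt_two (n + 2)).le

/-- **Every searched iterate is below `2^E`**: if `p(m) + 2 ≤ (m + 2)^{2^d}` then
`p_i(n) < 2^{E d n}` for all `i ≤ I d n`. [Hirahara 2021 (ECCC TR21-058), proof of Thm. 6.3]
[cite: Hirahara2021, Thm. 6.3 (proof)] -/
theorem iterate_lt_two_pow_E {p : Polynomial ℕ} {d : ℕ} (hp : ∀ m, p.eval m + 2 ≤ (m + 2) ^ (2 ^ d))
    (n : ℕ) {i : ℕ} (hi : i ≤ I d n) : (fun m => p.eval m)^[i] n < 2 ^ E d n := by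
  have h1 := iterate_add_two_le hp n i
  have hD : 1 ≤ 2 ^ d := Nat.one_le_two_pow
  have h2 : (n + 2) ^ ((2 ^ d) ^ i) ≤ (n + 2) ^ ((2 ^ d) ^ I d n) :=
    Nat.pow_le_pow_right (by omega) (Nat.pow_le_pow_right hD hi)
  have h3 : (n + 2) ^ ((2 ^ d) ^ I d n) ≤ 2 ^ E d n := by
    calc (n + 2) ^ ((2 ^ d) ^ I d n) ≤ (2 ^ (Nat.log 2 (n + 2) + 1)) ^ ((2 ^ d) ^ I d n) :=
          Nat.pow_le_pow_left (add_two_le_two_pow_log n) _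
      _ = 2 ^ E d n := by rw [← pow_mul, E, Nat.mul_comm]
  omega

/-! ### The exponent is `O(n / log n)` -/

/-- `(L + 3)² ≤ 18 · 2^{⌊L/2⌋}` for all `L` (the polylog estimate; equality at `L = 3`). [folklore] -/
theorem sq_add_three_le (L : ℕ) : (L + 3) ^ 2 ≤ 18 * 2 ^ (L / 2) := by
  -- two-step induction via the statement for `2j` and `2j + 1` together
  suffices h : ∀ j : ℕ, (2 * j + 3) ^ 2 ≤ 18 * 2 ^ j ∧ (2 * j + 4) ^ 2 ≤ 18 * 2 ^ j by
    obtain ⟨h0, h1⟩ := h (L / 2)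
    rcases Nat.even_or_odd' L with ⟨j, hj | hj⟩
    · have e : L / 2 = j := by omega
      rw [show L + 3 = 2 * j + 3 by omega, e]; rw [e] at h0; exact h0
    · have e : L / 2 = j := by omega
      rw [show L + 3 = 2 * j + 4 by omega, e]; rw [e] at h1; exact h1
  intro j
  induction j with
  | zero => norm_num
  | succ j ih =>
    obtain ⟨h0, h1⟩ := ih
    rcases Nat.lt_or_ge j 2 with hj2 | hj2
    · interval_cases j <;> norm_num
    · have hP : 4 ≤ 2 ^ j :=
        calc 4 = 2 ^ 2 := by norm_num
          _ ≤ 2 ^ j := Nat.pow_le_pow_right two_pos hj2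
      have hjP : j ≤ 2 ^ j := Nat.lt_two_pow_self.le
      have e : (2 : ℕ) ^ (j + 1) = 2 ^ j * 2 := pow_succ 2 j
      rw [e]
      constructor
      · nlinarith [h0, hjP, hP]
      · nlinarith [h1, hjP, hP]

/-- `(L + 1)² ≤ 4 · 2^L` for all `L`. [folklore] -/
theorem sq_succ_le (L : ℕ) : (L + 1) ^ 2 ≤ 4 * 2 ^ L := by
  induction L with
  | zero => norm_num
  | succ L ih =>
    have hL : L + 1 ≤ 2 ^ L := Nat.lt_two_pow_self
    have e : (2 : ℕ) ^ (L + 1) = 2 ^ L * 2 := pow_succ 2 L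
    rw [e]
    nlinarith [ih, hL]

/-- `(2^d)^{I d n} ≤ 2^d · 2^{⌊log₂ n⌋ / 2}` (`d · (L / (2d)) ≤ L / 2`). [folklore] -/
theorem pow_I_le (d n : ℕ) :
    (2 ^ d) ^ I d n ≤ 2 ^ d * 2 ^ (Nat.log 2 n / 2) := by
  have h : d * (Nat.log 2 n / (2 * d)) ≤ Nat.log 2 n / 2 := by
    rw [Nat.le_div_iff_mul_le two_pos]
    calc d * (Nat.log 2 n / (2 * d)) * 2 = 2 * d * (Nat.log 2 n / (2 * d)) := by ring
      _ ≤ Nat.log 2 n := Nat.mul_div_le _ _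
  calc (2 ^ d) ^ I d n = 2 ^ (d * (Nat.log 2 n / (2 * d)) + d) := by
        rw [I, ← pow_mul]; ring_nf
    _ ≤ 2 ^ (Nat.log 2 n / 2 + d) := Nat.pow_le_pow_right two_pos (by omega)
    _ = 2 ^ d * 2 ^ (Nat.log 2 n / 2) := by rw [pow_add, Nat.mul_comm]

/-- `(2^{⌊L/2⌋})² ≤ 2^L ≤ n` for `L = ⌊log₂ n⌋`, `n ≠ 0`. [folklore] -/
theorem two_pow_half_sq_le {n : ℕ} (hn : n ≠ 0) :
    2 ^ (Nat.log 2 n / 2) * 2 ^ (Nat.log 2 n / 2) ≤ n := by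
  rw [← pow_add]
  exact (Nat.pow_le_pow_right two_pos (by omega)).trans (Nat.pow_log_le_self 2 hn)

/-- The explicit constant of `mtot_mul_log_le`. [folklore] -/
def cpar (d a₀ : ℕ) : ℕ := 4 * d * (a₀ + 1) + 36 * 2 ^ d + 16

/-- `⌊log₂ (n + 2)⌋ ≤ ⌊log₂ n⌋ + 2` for `n ≥ 1` (`n + 2 ≤ 4n`). [folklore] -/
theorem log_add_two_le {n : ℕ} (hn : 0 < n) : Nat.log 2 (n + 2) ≤ Nat.log 2 n + 2 := by
  have h1 : Nat.log 2 (n * 2) = Nat.log 2 n + 1 := Nat.log_mul_base one_lt_two hn.ne'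
  have h2 : Nat.log 2 (n * 2 * 2) = Nat.log 2 (n * 2) + 1 := Nat.log_mul_base one_lt_two (by omega)
  calc Nat.log 2 (n + 2) ≤ Nat.log 2 (n * 2 * 2) := Nat.log_mono_right (by omega)
    _ = Nat.log 2 n + 2 := by rw [h2, h1]

/-- **The exponent is `O(n / log n)`.** For `d ≥ 1` and all `n`:
`mtot d a₀ n · ⌊log₂ n⌋ ≤ cpar d a₀ · n`. Ingredients (`L = ⌊log₂ n⌋`): `k · L ≤ 2d (n + a₀)`
(from `L < 2d · I` and `k · I ≤ n + a₀`), `I · L ≤ (L + 1)² ≤ 4 n`,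
`E · L ≤ 2^d 2^{L/2} (L + 3)² ≤ 18 · 2^d n` (`⌊log₂ (n+2)⌋ ≤ L + 2`), `L ≤ n`.
[Hirahara 2021 (ECCC TR21-058), proof of Thm. 6.3 (running-time estimate
`poly(p_I(n), 2^k) ≤ 2^{O(n / log n)}`)] [cite: Hirahara2021, Thm. 6.3 (proof)] -/
theorem mtot_mul_log_le (d a₀ : ℕ) (hd : 1 ≤ d) (n : ℕ) :
    mtot d a₀ n * Nat.log 2 n ≤ cpar d a₀ * n := by
  rcases Nat.eq_zero_or_pos n with rfl | hn
  · simp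
  have hLn : 2 ^ Nat.log 2 n ≤ n := Nat.pow_log_le_self 2 hn.ne'
  have hLle : Nat.log 2 n ≤ n := (Nat.lt_two_pow_self).le.trans hLn
  -- (a) k · L ≤ 2d (n + a₀)
  have hIL : Nat.log 2 n < 2 * d * I d n := by
    unfold I; exact Nat.lt_mul_div_succ _ (by omega)
  have hkI : k d a₀ n * I d n ≤ n + a₀ := Nat.div_mul_le_self _ _
  have ha : k d a₀ n * Nat.log 2 n ≤ 2 * d * (n + a₀) := by
    calc k d a₀ n * Nat.log 2 n ≤ k d a₀ n * (2 * d * I d n) := Nat.mul_le_mul_left _ hIL.le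
      _ = 2 * d * (k d a₀ n * I d n) := by ring
      _ ≤ 2 * d * (n + a₀) := Nat.mul_le_mul_left _ hkI
  -- (b) I · L ≤ 4 n and (L + 1) · L ≤ 4 n
  have hI_le : I d n ≤ Nat.log 2 n + 1 := by
    unfold I; have := Nat.div_le_self (Nat.log 2 n) (2 * d); omega
  have hb' : (Nat.log 2 n + 1) * Nat.log 2 n ≤ 4 * n := by
    calc (Nat.log 2 n + 1) * Nat.log 2 n ≤ (Nat.log 2 n + 1) * (Nat.log 2 n + 1) :=
          Nat.mul_le_mul_left _ (Nat.le_succ _)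
      _ = (Nat.log 2 n + 1) ^ 2 := (sq _).symm
      _ ≤ 4 * 2 ^ Nat.log 2 n := sq_succ_le _
      _ ≤ 4 * n := Nat.mul_le_mul_left 4 hLn
  have hb : I d n * Nat.log 2 n ≤ 4 * n := (Nat.mul_le_mul_right _ hI_le).trans hb'
  -- (c) E · L ≤ 18 · 2^d · n
  have hE : E d n ≤ 2 ^ d * 2 ^ (Nat.log 2 n / 2) * (Nat.log 2 n + 3) := by
    unfold E
    exact Nat.mul_le_mul (pow_I_le d n) (by have := log_add_two_le hn; omega)
  have hsq := sq_add_three_le (Nat.log 2 n)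
  have hhalf := two_pow_half_sq_le hn.ne'
  have hc : E d n * Nat.log 2 n ≤ 18 * 2 ^ d * n := by
    calc E d n * Nat.log 2 n ≤ 2 ^ d * 2 ^ (Nat.log 2 n / 2) * (Nat.log 2 n + 3) * Nat.log 2 n :=
          Nat.mul_le_mul_right _ hE
      _ ≤ 2 ^ d * 2 ^ (Nat.log 2 n / 2) * (Nat.log 2 n + 3) * (Nat.log 2 n + 3) :=
          Nat.mul_le_mul_left _ (by omega)
      _ = 2 ^ d * 2 ^ (Nat.log 2 n / 2) * (Nat.log 2 n + 3) ^ 2 := by ring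
      _ ≤ 2 ^ d * 2 ^ (Nat.log 2 n / 2) * (18 * 2 ^ (Nat.log 2 n / 2)) := Nat.mul_le_mul_left _ hsq
      _ = 18 * 2 ^ d * (2 ^ (Nat.log 2 n / 2) * 2 ^ (Nat.log 2 n / 2)) := by ring
      _ ≤ 18 * 2 ^ d * n := Nat.mul_le_mul_left _ hhalf
  -- sum
  have hsum : mtot d a₀ n * Nat.log 2 n = 2 * (k d a₀ n * Nat.log 2 n) + 2 * (E d n * Nat.log 2 n) +
      I d n * Nat.log 2 n + 4 * Nat.log 2 n + (Nat.log 2 n + 1) * Nat.log 2 n := by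
    unfold mtot m; ring
  have h4 : 4 * d * a₀ ≤ 4 * d * a₀ * n := Nat.le_mul_of_pos_right _ hn
  rw [hsum]
  calc 2 * (k d a₀ n * Nat.log 2 n) + 2 * (E d n * Nat.log 2 n) + I d n * Nat.log 2 n +
        4 * Nat.log 2 n + (Nat.log 2 n + 1) * Nat.log 2 n
      ≤ 2 * (2 * d * (n + a₀)) + 2 * (18 * 2 ^ d * n) + 4 * n + 4 * n + 4 * n := by
        gcongr
    _ = 4 * d * n + 4 * d * a₀ + 36 * 2 ^ d * n + 12 * n := by ring
    _ ≤ 4 * d * n + 4 * d * a₀ * n + 36 * 2 ^ d * n + 16 * n := by omega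
    _ = cpar d a₀ * n := by unfold cpar; ring

/-! ### The final time bound -/

/-- **Bookkeeping of the running time.** For `d ≥ 1` and all `A, B` there is a constant `c` with
`A · 2^{B · mtot(n)} + A ≤ c · 2^{c · n / ⌊log₂ n⌋} + c` for every `n` — the shape
`c · t n + c`, `t n = 2^{c n / ⌊log₂ n⌋}`, of membership in the tree's `DTIME t`
(for `n ≤ 1`, `⌊log₂ n⌋ = 0` and the right-hand side is `2c`). [Hirahara 2021 (ECCC TR21-058),
proof of Thm. 6.3 and Cor. 6.4 (`L ∈ DTIME(2^{O(n / log n)})`)] [cite: Hirahara2021, Cor. 6.4] -/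
theorem exists_time_bound (d a₀ : ℕ) (hd : 1 ≤ d) (A B : ℕ) :
    ∃ c : ℕ, ∀ n : ℕ, A * 2 ^ (B * mtot d a₀ n) + A ≤ c * 2 ^ (c * n / Nat.log 2 n) + c := by
  refine ⟨A * 2 ^ (B * mtot d a₀ 0) + A * 2 ^ (B * mtot d a₀ 1) + A + B * cpar d a₀, fun n => ?_⟩
  set c := A * 2 ^ (B * mtot d a₀ 0) + A * 2 ^ (B * mtot d a₀ 1) + A + B * cpar d a₀ with hc
  have hAc : A ≤ c := by omega
  rcases Nat.lt_or_ge n 2 with hn | hn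
  · -- `n ≤ 1`: both sides are constants
    have hlog : Nat.log 2 n = 0 := Nat.log_of_lt hn
    rw [hlog, Nat.div_zero, pow_zero, mul_one]
    interval_cases n <;> omega
  · have hL : 0 < Nat.log 2 n := Nat.log_pos one_lt_two hn
    have h1 : mtot d a₀ n ≤ cpar d a₀ * n / Nat.log 2 n :=
      (Nat.le_div_iff_mul_le hL).2 (mtot_mul_log_le d a₀ hd n)
    have h2 : B * mtot d a₀ n ≤ c * n / Nat.log 2 n :=
      calc B * mtot d a₀ n ≤ B * (cpar d a₀ * n / Nat.log 2 n) := Nat.mul_le_mul_left B h1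
        _ ≤ B * (cpar d a₀ * n) / Nat.log 2 n := Nat.mul_div_le_mul_div_assoc _ _ _
        _ = B * cpar d a₀ * n / Nat.log 2 n := by rw [Nat.mul_assoc]
        _ ≤ c * n / Nat.log 2 n := Nat.div_le_div_right (Nat.mul_le_mul_right n (by omega))
    calc A * 2 ^ (B * mtot d a₀ n) + A ≤ c * 2 ^ (B * mtot d a₀ n) + c := by gcongr
      _ ≤ c * 2 ^ (c * n / Nat.log 2 n) + c := by
          gcongr
          exact one_le_two

end UHSParam

end Literature.Computability.MetaComplexity
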